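import Mathlib
import Summits.RiemannHypothesis.RiemannHypothesis.Theorems.JensenPolynomialsDefs
import Summits.RiemannHypothesis.RiemannHypothesis.Theorems.JensenWindowTable
import Literature.NumberTheory.LFunctions.XiMoments

/-! # JensenWindowTableTransfer — `rhoWinMin ≤ rhoWin` pointwise (`3 ≤ d`) and the A-FORTIORI TRANSFER: every coefficient-smallness
statement S-C for the window table `rhoWin` gives the one for the route's table `rhoWinMin`
(`xiGorttwCoeffSmallBelow/From_rhoWinMin_of_rhoWin`; the bound-row constants satisfy `bndRow5 ≤ 24/5` from `d ≥ 70` and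
`bndRow6 ≤ 6` from `d ≥ 116`, sharp).  RH-FREE; the only `ξ`-dependence is through the smallness schemas of the Defs file.
Verbatim port of HOME `rh-jensen-theory/JensenTargets.lean` v4.6 §8.11 (end) (cell rh-jensen, D-0040; D-0064(4)); supports the route's
TABLE crux `JensenPolynomials.XiGorttwCoeffSmallTable` (every engine certificate is for `rhoWin`).  Nothing here bears on the zeros of `ζ`. -/

noncomputable section
set_option linter.dupNamespace false

open Polynomial Finset
open scoped Nat

namespace Summit.RiemannHypothesis.RiemannHypothesis.Theorems.JensenPolynomials

open Literature.NumberTheory.LFunctions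

/-- `bndRow5 d ≤ 24/5` for `d ≥ 70` (sharp threshold). -/
theorem bndRow5_le {d : ℝ} (hd : 70 ≤ d) : bndRow5 d ≤ 24 / 5 := by
  unfold bndRow5
  have h1 : 0 < d - 1 := by linarith
  have h2 : 0 < d - 2 := by linarith
  have h3 : 0 < d - 3 := by linarith
  have h4 : 0 < d - 4 := by linarith
  rw [div_le_iff₀ (by positivity)]
  obtain ⟨e, he, rfl⟩ : ∃ e : ℝ, 0 ≤ e ∧ d = e + 70 := ⟨d - 70, by linarith, by ring⟩
  nlinarith [he, pow_nonneg he 2, pow_nonneg he 3, pow_nonneg he 4]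

/-- `bndRow6 d ≤ 6` for `d ≥ 116` (sharp threshold). -/
theorem bndRow6_le {d : ℝ} (hd : 116 ≤ d) : bndRow6 d ≤ 6 := by
  unfold bndRow6
  have h1 : 0 < d - 1 := by linarith
  have h2 : 0 < d - 2 := by linarith
  have h3 : 0 < d - 3 := by linarith
  have h4 : 0 < d - 4 := by linarith
  have h5 : 0 < d - 5 := by linarith
  rw [div_le_iff₀ (by positivity)]
  obtain ⟨e, he, rfl⟩ : ∃ e : ℝ, 0 ≤ e ∧ d = e + 116 := ⟨d - 116, by linarith, by ring⟩
  nlinarith [he, pow_nonneg he 2, pow_nonneg he 3, pow_nonneg he 4, pow_nonneg he 5]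

/-- **`rhoWinMin ≤ rhoWin` pointwise on `3 ≤ d` (PROVED).** -/
theorem rhoWinMin_le_rhoWin (d j : ℕ) (hd : 3 ≤ d) : rhoWinMin d j ≤ rhoWin d j := by
  unfold rhoWinMin rhoWin
  by_cases h4 : j ≤ 4
  · simp only [if_pos h4]; exact le_rfl
  · simp only [if_neg h4]
    by_cases h5 : j = 5 ∧ 8 ≤ d
    · rw [if_pos h5]
      obtain ⟨rfl, h8⟩ := h5
      by_cases hw : 4 * (5 - 2) ^ 3 ≤ d
      · rw [if_pos hw]
        refine (min_le_right _ _).trans ?_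
        have hd' : (70 : ℝ) ≤ d := by exact_mod_cast (show 70 ≤ d by norm_num at hw; omega)
        have hpos : (0 : ℝ) < (2 * (d : ℝ)) ^ (((5 : ℕ) : ℝ) / 2) := by positivity
        have hb : bndRow5 (d : ℝ) ≤ 6 / 5 * (((5 : ℕ) : ℝ) - 1) := by
          have := bndRow5_le hd'; push_cast; linarith
        exact div_le_div_of_nonneg_right hb hpos.le
      · rw [if_neg hw]; exact min_le_left _ _
    · rw [if_neg h5]
      by_cases h6 : j = 6 ∧ 9 ≤ d
      · rw [if_pos h6]
        obtain ⟨rfl, h9⟩ := h6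
        by_cases hw : 4 * (6 - 2) ^ 3 ≤ d
        · rw [if_pos hw]
          refine (min_le_right _ _).trans ?_
          have hd' : (116 : ℝ) ≤ d := by exact_mod_cast (show 116 ≤ d by norm_num at hw; omega)
          have hpos : (0 : ℝ) < (2 * (d : ℝ)) ^ (((6 : ℕ) : ℝ) / 2) := by positivity
          have hb : bndRow6 (d : ℝ) ≤ 6 / 5 * (((6 : ℕ) : ℝ) - 1) := by
            have := bndRow6_le hd'; push_cast; linarith
          exact div_le_div_of_nonneg_right hb hpos.le
        · rw [if_neg hw]; exact min_le_left _ _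
      · rw [if_neg h6]

/-- Smallness w.r.t. a table transfers to any pointwise-smaller table (on `3 ≤ d`, `1 ≤ j ≤ d`). -/
theorem xiGorttwCoeffSmallBelow_mono {ρ ρ' : ℕ → ℕ → ℝ} {N : ℕ}
    (h : ∀ d j, 3 ≤ d → 1 ≤ j → j ≤ d → ρ' d j ≤ ρ d j) :
    XiGorttwCoeffSmallBelow ρ N → XiGorttwCoeffSmallBelow ρ' N := by
  intro hB d n hd hn hN
  obtain ⟨h1, h2⟩ := hB d n hd hn hN
  refine ⟨lt_of_le_of_lt (Finset.sum_le_sum fun j hj => ?_) h1, h2⟩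
  have := mem_range.1 hj
  exact mul_le_mul_of_nonneg_left (h d (j + 1) hd (by omega) (by omega)) (abs_nonneg _)

/-- Smallness FROM a shift transfers to any pointwise-smaller table (on `3 ≤ d`, `1 ≤ j ≤ d`). -/
theorem xiGorttwCoeffSmallFrom_mono {ρ ρ' : ℕ → ℕ → ℝ} {N : ℕ}
    (h : ∀ d j, 3 ≤ d → 1 ≤ j → j ≤ d → ρ' d j ≤ ρ d j) :
    XiGorttwCoeffSmallFrom ρ N → XiGorttwCoeffSmallFrom ρ' N := by
  intro hB d n hd hn hN
  obtain ⟨h1, h2⟩ := hB d n hd hn hN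
  refine ⟨lt_of_le_of_lt (Finset.sum_le_sum fun j hj => ?_) h1, h2⟩
  have := mem_range.1 hj
  exact mul_le_mul_of_nonneg_left (h d (j + 1) hd (by omega) (by omega)) (abs_nonneg _)

/-- Smallness (all shifts) transfers to any pointwise-smaller table (on `3 ≤ d`, `1 ≤ j ≤ d`). -/
theorem xiGorttwCoeffSmall_mono {ρ ρ' : ℕ → ℕ → ℝ}
    (h : ∀ d j, 3 ≤ d → 1 ≤ j → j ≤ d → ρ' d j ≤ ρ d j) :
    XiGorttwCoeffSmall ρ → XiGorttwCoeffSmall ρ' := by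
  intro hB d n hd hn
  obtain ⟨h1, h2⟩ := hB d n hd hn
  refine ⟨lt_of_le_of_lt (Finset.sum_le_sum fun j hj => ?_) h1, h2⟩
  have := mem_range.1 hj
  exact mul_le_mul_of_nonneg_left (h d (j + 1) hd (by omega) (by omega)) (abs_nonneg _)

/-- **A-FORTIORI TRANSFER (PROVED): every smallness statement for `rhoWin` gives the one for the route's table `rhoWinMin`.** -/
theorem xiGorttwCoeffSmallBelow_rhoWinMin_of_rhoWin (N : ℕ) :
    XiGorttwCoeffSmallBelow rhoWin N → XiGorttwCoeffSmallBelow rhoWinMin N :=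
  xiGorttwCoeffSmallBelow_mono fun d j hd _ _ => rhoWinMin_le_rhoWin d j hd

/-- A-fortiori transfer FROM a shift: smallness for `rhoWin` gives smallness for the route's table `rhoWinMin`. -/
theorem xiGorttwCoeffSmallFrom_rhoWinMin_of_rhoWin (N : ℕ) :
    XiGorttwCoeffSmallFrom rhoWin N → XiGorttwCoeffSmallFrom rhoWinMin N :=
  xiGorttwCoeffSmallFrom_mono fun d j hd _ _ => rhoWinMin_le_rhoWin d j hd
end Summit.RiemannHypothesis.RiemannHypothesis.Theorems.JensenPolynomials

end
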